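import Summits.ResolutionOfSingularities.ResolutionOfSingularities.Theorems.EquisingularLiftEquisingularLiftNatSpecimenWhitneyCubicAlgebra
import Literature.AlgebraicGeometry.Resolution.BlowupAlgebraPresentation
import Literature.AlgebraicGeometry.Resolution.BlowupAlgebraStrictTransform
import Literature.AlgebraicGeometry.Resolution.BlowupAlgebraDerivations
import Literature.AlgebraicGeometry.Resolution.RegularDerivationQuotient
import Mathlib.Algebra.MvPolynomial.PDeriv
import HarnessLib

/-!
# [OURS · L1 W4.5(b)] T-ISO-1 algebra layer, 0: Stacks 07PF with several derivations and the generic strict-transform chart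

Helper for the research stub `stub_elnat_three_isolated_nonabs` of the crux `EquisingularLiftNat`
(stmt-ResolutionOfSingularities-20038; route `EquisingularLift`, chain w45b, CHAIN v7.1 §3 row
T-ISO-1 «downstairs charts p504547 (stub-4) → assembly»; also the downstairs ∃-discharge of the
quartic instance of res-L1-w45b-lead-2's rungs T-Δ-ISO / T-ISO-0⁺). NOT a statement of any manuscript;
AI-written kernel lemma of the cell `res-hironaka` (weaker than expert review).

The quartic specimen of T-ISO-1 (`H = V(x₀²x₃² + x₁⁴ + x₂⁴)`, lead-2) needs, after the point step, the
blow-up of an `A₁` double LINE inside the exceptional plane; its strict-transform chart `t² + 1 + y₀⁴`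
is smooth but NO single derivation takes it to a unit modulo itself, so R2's generic chart lemma
`WhitneyCubic.isRegularRing_blowupAlgebra_quotient` (one derivation `∂/∂y₀`, p507017) does not apply.
This file supplies the local form, in the SAME currency (centre `WhitneyCubic.cen = (y₁, y₂) ⊂
A = k[y₀, y₁, y₂]`, chart rings `A[I/yᵢ]`, reused by import):

* `not_mem_sq_of_derivation_not_mem`, **`isRegularRing_quotient_of_derivations`** — Stacks 07PF, LOCAL
  multi-derivation form: `C` regular and, for every prime `Q ∋ f`, SOME derivation `D` of `C` with
  `D f ∉ Q` ⟹ `C/(f)` regular (the tree's `isRegularRing_quotient_of_derivation` is the case of one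
  `D` with `D f` a unit mod `f`); `mem_of_two_mul_mem`, `mem_of_four_mul_mem` (bookkeeping with `2 ∈ kˣ`);
* **`isRegularRing_blowupAlgebra_quotient_of_derivations`** — R2's generic strict-transform chart
  `(A/(f))[Ī/b̄] ≅ A[I/b]/(f′)` (GW 13.96 (2), Stacks 0BIQ) with the local criterion as hypothesis;
* `apply_mem_span_cen_of_apply_cen_mem`, `exists_derivation_d0`, **`exists_derivation_chart₀_dt`**,
  **`exists_derivation_chart₁_ds`** — the plain extensions to the chart rings of `∂/∂y₀` (kills the
  fractions), of `y₁·∂/∂y₂` to `A[I/y₁]` (`= ∂/∂t`, `t = y₂/y₁ ↦ 1`) and of `y₂·∂/∂y₁` to `A[I/y₂]`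
  (`= ∂/∂s`, `s = y₁/y₂ ↦ 1`) (`exists_derivation_blowupAlgebra_of_apply_eq_zero` of the tree).

Consumers: `…NatSpecimenQuarticLineStep.lean` (the two line-step charts and the smooth affine charts
of `H`), `…NatSpecimenQuarticPointStep.lean` (the point step).

References: The Stacks Project, Tags 07PF, 0BIQ, 052Q; Görtz–Wedhorn I, Prop. 13.96 (2); Liu 2002,
Thm 8.1.19 (a) — through the cited tree files (`RegularDerivationQuotient`, `BlowupAlgebraPresentation`,
`BlowupAlgebraStrictTransform`, `BlowupAlgebraDerivations`).
-/

set_option linter.dupNamespace false -- mandated namespace `Summit.<Summit>.<Problem>` of this single-conjunct summit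

noncomputable section

open MvPolynomial IsLocalRing
open Literature.AlgebraicGeometry.Resolution
open Summit.ResolutionOfSingularities.ResolutionOfSingularities.Cruxes.EquisingularLiftNat.Sections

namespace Summit.ResolutionOfSingularities.ResolutionOfSingularities.Theorems.EquisingularLift.SpecimenQuartic

universe u

/-! ## Stacks 07PF, local multi-derivation form -/

section Stacks07PFLocal

variable {C : Type u} [CommRing C]

/-- Local form of `not_mem_sq_of_derivation_unit`: if `D f ∉ Q` for a derivation `D` and a prime
`Q ∋ f`, then `u·f ∉ Q²` for every `u ∉ Q` (Leibniz: `D(Q²) ⊆ Q`). [cite: StacksProject, Tag 07PF] -/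
theorem not_mem_sq_of_derivation_not_mem {S₀ : Type*} [CommSemiring S₀] [Algebra S₀ C] (f : C)
    (D : Derivation S₀ C C) (Q : Ideal C) [Q.IsPrime] (hfQ : f ∈ Q) (hDf : D f ∉ Q) {u : C}
    (hu : u ∉ Q) : u * f ∉ Q ^ 2 := by
  intro huf
  have key : ∀ x ∈ Q ^ 2, D x ∈ Q := by
    intro x hx
    rw [pow_two] at hx
    refine Submodule.mul_induction_on hx (fun a ha b hb => ?_) (fun a b ha hb => ?_)
    · rw [Derivation.leibniz, smul_eq_mul, smul_eq_mul]
      exact Q.add_mem (Q.mul_mem_right _ ha) (Q.mul_mem_right _ hb)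
    · rw [map_add]
      exact Q.add_mem ha hb
  have h1 : D (u * f) ∈ Q := key _ huf
  rw [Derivation.leibniz, smul_eq_mul, smul_eq_mul] at h1
  have h2 : u * D f ∈ Q := (Ideal.add_mem_iff_left Q (Q.mul_mem_right _ hfQ)).mp h1
  exact hDf (((Ideal.IsPrime.mem_or_mem ‹_› h2).resolve_left hu))

/-- **Stacks 07PF, local form with several derivations.** Let `C` be a regular ring and `f ∈ C`
such that for every prime `Q ∋ f` there is a derivation `D` of `C` with `D f ∉ Q`. Then `C/(f)` is
a regular ring. (At `Q`, `f ∈ QC_Q ∖ Q²C_Q`, so `C_Q/(f)` is regular local.) The proof is the tree's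
`isRegularRing_quotient_of_derivation` with the unit hypothesis localised. [cite: StacksProject, Tag 07PF] -/
theorem isRegularRing_quotient_of_derivations [IsRegularRing C] {S₀ : Type*} [CommSemiring S₀]
    [Algebra S₀ C] (f : C)
    (hD : ∀ Q : Ideal C, Q.IsPrime → f ∈ Q → ∃ D : Derivation S₀ C C, D f ∉ Q) :
    IsRegularRing (C ⧸ Ideal.span {f}) := by
  refine isRegularRing_iff.mpr fun P hP => ?_
  let Q : Ideal C := P.comap (Ideal.Quotient.mk (Ideal.span {f}))
  haveI hQ : Q.IsPrime := Ideal.comap_isPrime _ P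
  have hf0 : Ideal.Quotient.mk (Ideal.span {f}) f = 0 :=
    Ideal.Quotient.eq_zero_iff_mem.mpr (Ideal.subset_span (Set.mem_singleton f))
  have hfQ : f ∈ Q := by
    change Ideal.Quotient.mk (Ideal.span {f}) f ∈ P
    rw [hf0]
    exact P.zero_mem
  obtain ⟨D, hDf⟩ := hD Q hQ hfQ
  have hfm : algebraMap C (Localization.AtPrime Q) f ∈ maximalIdeal (Localization.AtPrime Q) := by
    rw [← Localization.AtPrime.map_eq_maximalIdeal]
    exact Ideal.mem_map_of_mem _ hfQ
  have hfm2 : algebraMap C (Localization.AtPrime Q) f ∉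
      maximalIdeal (Localization.AtPrime Q) ^ 2 := by
    rw [← Localization.AtPrime.map_eq_maximalIdeal, ← Ideal.map_pow,
      IsLocalization.algebraMap_mem_map_algebraMap_iff Q.primeCompl]
    rintro ⟨u, hu, huf⟩
    exact not_mem_sq_of_derivation_not_mem f D Q hfQ hDf hu huf
  have hreg : IsRegularLocalRing
      (Localization.AtPrime Q ⧸ Ideal.span {algebraMap C (Localization.AtPrime Q) f}) :=
    (IsRegularLocalRing.quotient_span_singleton hfm hfm2).1
  have hmap : (Ideal.span {f}).map (algebraMap C (Localization.AtPrime Q)) =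
      Ideal.span {algebraMap C (Localization.AtPrime Q) f} := by
    rw [Ideal.map_span, Set.image_singleton]
  have hsub : Algebra.algebraMapSubmonoid (C ⧸ Ideal.span {f}) Q.primeCompl = P.primeCompl := by
    ext x
    constructor
    · rintro ⟨c, hc, rfl⟩
      exact hc
    · intro hx
      obtain ⟨c, rfl⟩ := Ideal.Quotient.mk_surjective x
      exact ⟨c, hx, rfl⟩
  haveI : IsLocalization.AtPrime
      (Localization.AtPrime Q ⧸ (Ideal.span {f}).map (algebraMap C (Localization.AtPrime Q)))
      P := by
    change IsLocalization P.primeCompl _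
    rw [← hsub]
    infer_instance
  let e : Localization.AtPrime P ≃ₐ[C ⧸ Ideal.span {f}]
      Localization.AtPrime Q ⧸ (Ideal.span {f}).map (algebraMap C (Localization.AtPrime Q)) :=
    IsLocalization.algEquiv P.primeCompl _ _
  let e' : (Localization.AtPrime Q ⧸ (Ideal.span {f}).map (algebraMap C (Localization.AtPrime Q)))
      ≃+* Localization.AtPrime Q ⧸ Ideal.span {algebraMap C (Localization.AtPrime Q) f} :=
    Ideal.quotEquivOfEq hmap
  haveI := hreg
  exact IsRegularLocalRing.of_ringEquiv (e.toRingEquiv.trans e').symm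

/-- In a prime ideal not containing the unit `2`, `2·x ∈ Q` forces `x ∈ Q`. [folklore] -/
theorem mem_of_two_mul_mem {Q : Ideal C} (hQ : Q.IsPrime) (h2 : IsUnit (2 : C)) {x : C}
    (h : 2 * x ∈ Q) : x ∈ Q :=
  (hQ.mem_or_mem h).resolve_left fun h2Q => hQ.ne_top (Ideal.eq_top_of_isUnit_mem _ h2Q h2)

/-- In a prime ideal not containing the unit `2`, `4·x ∈ Q` forces `x ∈ Q`. [folklore] -/
theorem mem_of_four_mul_mem {Q : Ideal C} (hQ : Q.IsPrime) (h2 : IsUnit (2 : C)) {x : C}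
    (h : 4 * x ∈ Q) : x ∈ Q := by
  have h' : 2 * (2 * x) ∈ Q := by
    have e : (2 : C) * (2 * x) = 4 * x := by ring
    rwa [e]
  exact mem_of_two_mul_mem hQ h2 (mem_of_two_mul_mem hQ h2 h')

end Stacks07PFLocal

/-! ## The generic strict-transform chart with the local criterion -/

section Generic

variable (k : Type) [Field k]

/-- A derivation sending the generators of `I = (y₁, y₂)` into `I` preserves `I`. [folklore] -/
theorem apply_mem_span_cen_of_apply_cen_mem (δ : Derivation k (MvPolynomial (Fin 3) k) (MvPolynomial (Fin 3) k))
    (h : ∀ j, δ (WhitneyCubic.cen k j) ∈ Ideal.span (Set.range (WhitneyCubic.cen k)))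
    {y : MvPolynomial (Fin 3) k} (hy : y ∈ Ideal.span (Set.range (WhitneyCubic.cen k))) :
    δ y ∈ Ideal.span (Set.range (WhitneyCubic.cen k)) := by
  refine Submodule.span_induction (p := fun y _ => δ y ∈ Ideal.span (Set.range (WhitneyCubic.cen k)))
    ?_ ?_ ?_ ?_ hy
  · rintro _ ⟨j, rfl⟩
    exact h j
  · rw [map_zero]
    exact Ideal.zero_mem _
  · intro a b _ _ ha hb
    rw [map_add]
    exact Ideal.add_mem _ ha hb
  · intro c a ha hca
    rw [smul_eq_mul, Derivation.leibniz, smul_eq_mul, smul_eq_mul]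
    exact Ideal.add_mem _ (Ideal.mul_mem_left _ _ hca) (Ideal.mul_mem_right _ _ ha)

/-- **GENERIC STRICT-TRANSFORM CHART, local criterion.** As R2's `isRegularRing_blowupAlgebra_quotient`
(`b = cen i`, `B = A[I/b]`, `f = bⁿ·f′`, `f′ = G(y_j/b)`, a coefficient of `G` outside `I`), but with the
unit hypothesis on `∂/∂y₀` replaced by: for every prime `Q ∋ f′` of `B` SOME derivation of `B` takes
`f′` outside `Q`. Then `(A/(f))[Ī/b̄] ≅ B/(f′)` is a regular ring.
[folklore; GW Prop. 13.96 (2), Stacks 07PF, 0BIQ] -/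
theorem isRegularRing_blowupAlgebra_quotient_of_derivations (i : Fin 2) {f : MvPolynomial (Fin 3) k} {n : ℕ}
    (G : MvPolynomial {j : Fin 2 // j ≠ i} (MvPolynomial (Fin 3) k))
    (hf : algebraMap (MvPolynomial (Fin 3) k) (blowupAlgebra (Ideal.span (Set.range (WhitneyCubic.cen k))) (WhitneyCubic.cen k i)) f =
      algebraMap (MvPolynomial (Fin 3) k) (blowupAlgebra (Ideal.span (Set.range (WhitneyCubic.cen k))) (WhitneyCubic.cen k i))
        (WhitneyCubic.cen k i) ^ n * blowupAlgebra.eval (WhitneyCubic.cen k) i G)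
    {m : {j : Fin 2 // j ≠ i} →₀ ℕ} (hm : G.coeff m ∉ Ideal.span (Set.range (WhitneyCubic.cen k)))
    (hD : ∀ Q : Ideal (blowupAlgebra (Ideal.span (Set.range (WhitneyCubic.cen k))) (WhitneyCubic.cen k i)),
      Q.IsPrime → blowupAlgebra.eval (WhitneyCubic.cen k) i G ∈ Q →
      ∃ D : Derivation k (blowupAlgebra (Ideal.span (Set.range (WhitneyCubic.cen k))) (WhitneyCubic.cen k i))
          (blowupAlgebra (Ideal.span (Set.range (WhitneyCubic.cen k))) (WhitneyCubic.cen k i)),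
        D (blowupAlgebra.eval (WhitneyCubic.cen k) i G) ∉ Q) :
    IsRegularRing (blowupAlgebra ((Ideal.span (Set.range (WhitneyCubic.cen k))).map (Ideal.Quotient.mk (Ideal.span {f})))
      (Ideal.Quotient.mk (Ideal.span {f}) (WhitneyCubic.cen k i))) := by
  haveI := WhitneyCubic.isRegularRing_chart k i
  haveI hreg : IsRegularRing (blowupAlgebra (Ideal.span (Set.range (WhitneyCubic.cen k))) (WhitneyCubic.cen k i) ⧸
      Ideal.span {blowupAlgebra.eval (WhitneyCubic.cen k) i G}) :=
    isRegularRing_quotient_of_derivations _ hD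
  have hndvd : ¬ algebraMap _ (blowupAlgebra (Ideal.span (Set.range (WhitneyCubic.cen k))) (WhitneyCubic.cen k i))
      (WhitneyCubic.cen k i) ∣ blowupAlgebra.eval (WhitneyCubic.cen k) i G := fun h =>
    hm ((blowupAlgebra.eval_mem_span_algebraMap_iff (WhitneyCubic.cen k) i (WhitneyCubic.isQuasiRegular_cen k) G).mp
      (Ideal.mem_span_singleton.mpr h) m)
  exact IsRegularRing.of_ringEquiv
    (R := blowupAlgebra (Ideal.span (Set.range (WhitneyCubic.cen k))) (WhitneyCubic.cen k i) ⧸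
      Ideal.span {blowupAlgebra.eval (WhitneyCubic.cen k) i G})
    (blowupAlgebra.quotientKerMapQuotientEquiv _ _ hf (WhitneyCubic.prime_algebraMap_cen k i) hndvd)

/-! ## The plain extensions `∂/∂y₀`, `∂/∂t = (y₁∂/∂y₂)~`, `∂/∂s = (y₂∂/∂y₁)~` -/

/-- The plain extension of `∂/∂y₀` to `A[I/b]` (`b = cen i`): `D₀(r) = ∂₀ r` on `A` and `D₀(y_j/b) = 0`.
[folklore] -/
theorem exists_derivation_d0 (i : Fin 2) :
    ∃ D : Derivation k (blowupAlgebra (Ideal.span (Set.range (WhitneyCubic.cen k))) (WhitneyCubic.cen k i))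
        (blowupAlgebra (Ideal.span (Set.range (WhitneyCubic.cen k))) (WhitneyCubic.cen k i)),
      (∀ r, D (algebraMap _ _ r) = algebraMap _ _ ((pderiv 0 : Derivation k (MvPolynomial (Fin 3) k) _) r)) ∧
      ∀ j, D (blowupAlgebra.frac (WhitneyCubic.cen k) i j) = 0 := by
  obtain ⟨D, hD, hDgen⟩ := exists_derivation_blowupAlgebra_of_apply_eq_zero
    (I := Ideal.span (Set.range (WhitneyCubic.cen k))) (a := WhitneyCubic.cen k i) k (pderiv 0)
    (WhitneyCubic.pderiv_zero_cen k i) (fun y hy => WhitneyCubic.pderiv_zero_mem k hy)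
  exact ⟨D, hD, fun j => blowupAlgebra.derivation_frac_eq_zero_of_apply_eq_zero (WhitneyCubic.cen k) i k D (pderiv 0)
    (fun y hy => WhitneyCubic.pderiv_zero_mem k hy) hDgen j (WhitneyCubic.pderiv_zero_cen k j)⟩

/-- **`∂/∂t` on `A[I/y₁]`** (`t = y₂/y₁`): the plain extension of the derivation `y₁·∂/∂y₂` of `A`
(it kills `y₁` and maps `I` into `I`) satisfies `D(r) = y₁ ∂₂ r` on `A` — so `D(y₀) = D(y₁) = 0` —
and `D(t) = y₁/y₁ = 1`. [folklore] -/
theorem exists_derivation_chart₀_dt :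
    ∃ D : Derivation k (blowupAlgebra (Ideal.span (Set.range (WhitneyCubic.cen k))) (WhitneyCubic.cen k 0))
        (blowupAlgebra (Ideal.span (Set.range (WhitneyCubic.cen k))) (WhitneyCubic.cen k 0)),
      (∀ r, D (algebraMap _ _ r) =
        algebraMap _ _ (((X 1 : MvPolynomial (Fin 3) k) • (pderiv 2 : Derivation k (MvPolynomial (Fin 3) k) _)) r)) ∧
      D (blowupAlgebra.frac (WhitneyCubic.cen k) 0 1) = 1 := by
  set δ : Derivation k (MvPolynomial (Fin 3) k) (MvPolynomial (Fin 3) k) :=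
    (X 1 : MvPolynomial (Fin 3) k) • (pderiv 2 : Derivation k (MvPolynomial (Fin 3) k) _) with hδ
  have hδ1 : δ (WhitneyCubic.cen k 0) = 0 := by
    simp [δ, Derivation.coe_smul]
  have hδ2 : δ (WhitneyCubic.cen k 1) = WhitneyCubic.cen k 0 := by
    simp [δ, Derivation.coe_smul]
  have hδI : ∀ y ∈ Ideal.span (Set.range (WhitneyCubic.cen k)), δ y ∈ Ideal.span (Set.range (WhitneyCubic.cen k)) := by
    intro y hy
    refine apply_mem_span_cen_of_apply_cen_mem k δ (fun j => ?_) hy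
    fin_cases j
    · rw [show WhitneyCubic.cen k ((fun i => i) ⟨0, by norm_num⟩) = WhitneyCubic.cen k 0 from rfl, hδ1]
      exact Ideal.zero_mem _
    · rw [show WhitneyCubic.cen k ((fun i => i) ⟨1, by norm_num⟩) = WhitneyCubic.cen k 1 from rfl, hδ2]
      exact blowupAlgebra.mem_span_range _ 0
  obtain ⟨D, hD, hDgen⟩ := exists_derivation_blowupAlgebra_of_apply_eq_zero
    (I := Ideal.span (Set.range (WhitneyCubic.cen k))) (a := WhitneyCubic.cen k 0) k δ hδ1 hδI
  refine ⟨D, hD, ?_⟩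
  rw [blowupAlgebra.frac, hDgen]
  apply Subtype.ext
  rw [blowupAlgebra.coe_gen, hδ2]
  exact IsLocalization.Away.mul_invSelf (WhitneyCubic.cen k 0)

/-- **`∂/∂s` on `A[I/y₂]`** (`s = y₁/y₂`): the plain extension of `y₂·∂/∂y₁` satisfies
`D(r) = y₂ ∂₁ r` on `A` and `D(s) = 1`. [folklore] -/
theorem exists_derivation_chart₁_ds :
    ∃ D : Derivation k (blowupAlgebra (Ideal.span (Set.range (WhitneyCubic.cen k))) (WhitneyCubic.cen k 1))
        (blowupAlgebra (Ideal.span (Set.range (WhitneyCubic.cen k))) (WhitneyCubic.cen k 1)),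
      (∀ r, D (algebraMap _ _ r) =
        algebraMap _ _ (((X 2 : MvPolynomial (Fin 3) k) • (pderiv 1 : Derivation k (MvPolynomial (Fin 3) k) _)) r)) ∧
      D (blowupAlgebra.frac (WhitneyCubic.cen k) 1 0) = 1 := by
  set δ : Derivation k (MvPolynomial (Fin 3) k) (MvPolynomial (Fin 3) k) :=
    (X 2 : MvPolynomial (Fin 3) k) • (pderiv 1 : Derivation k (MvPolynomial (Fin 3) k) _) with hδ
  have hδ2 : δ (WhitneyCubic.cen k 1) = 0 := by
    simp [δ, Derivation.coe_smul]
  have hδ1 : δ (WhitneyCubic.cen k 0) = WhitneyCubic.cen k 1 := by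
    simp [δ, Derivation.coe_smul]
  have hδI : ∀ y ∈ Ideal.span (Set.range (WhitneyCubic.cen k)), δ y ∈ Ideal.span (Set.range (WhitneyCubic.cen k)) := by
    intro y hy
    refine apply_mem_span_cen_of_apply_cen_mem k δ (fun j => ?_) hy
    fin_cases j
    · rw [show WhitneyCubic.cen k ((fun i => i) ⟨0, by norm_num⟩) = WhitneyCubic.cen k 0 from rfl, hδ1]
      exact blowupAlgebra.mem_span_range _ 1
    · rw [show WhitneyCubic.cen k ((fun i => i) ⟨1, by norm_num⟩) = WhitneyCubic.cen k 1 from rfl, hδ2]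
      exact Ideal.zero_mem _
  obtain ⟨D, hD, hDgen⟩ := exists_derivation_blowupAlgebra_of_apply_eq_zero
    (I := Ideal.span (Set.range (WhitneyCubic.cen k))) (a := WhitneyCubic.cen k 1) k δ hδ2 hδI
  refine ⟨D, hD, ?_⟩
  rw [blowupAlgebra.frac, hDgen]
  apply Subtype.ext
  rw [blowupAlgebra.coe_gen, hδ1]
  exact IsLocalization.Away.mul_invSelf (WhitneyCubic.cen k 1)

end Generic

end Summit.ResolutionOfSingularities.ResolutionOfSingularities.Theorems.EquisingularLift.SpecimenQuartic

end
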